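import Summits.ResolutionOfSingularities.ResolutionOfSingularities.Theorems.FrobeniusClosingPatchingRelPerfectChartTransversalPair
import HarnessLib

/-!
# Crux `PatchingRelPerfect` (stmt-ResolutionOfSingularities-16161), chain w52 — rung toolkit:
# the transports a three-letter step needs for its next step (brick 4)

[OURS · L1 W5.2 · rung tool] Continues bricks 1–3 (`…ChartTransversal.lean`, `…ChartPrincipalStrict.lean`,
`…ChartTransversalPair.lean`): codimension-two centre `(t, ℓ)`, `C` the `ℓ`-chart, `u' = t/ℓ`, a second
hypersurface `V(o)`.  Here the values of brick 2's isomorphism on the classes of `φ r` (`↦ r̄`) transport the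
hypotheses of a three-letter step to the next level:

* `quot_bot_blowupAlgebra_exists_equiv` — `R[I/b] ⧸ (r̄) ≅ R ⧸ (r)`, `[algebraMap x] ↦ [x]`;
* `transv_chartBase_notMem_pair` — `r ∉ (t) + (o) ⇒ φ r ∉ (u') + (φ o)` (e.g. `r = ℓ`: the letter `ℓ`
  does not vanish on the next centre), through brick 2's `C/(u') ≅ A/(t)`;
* `transv_isDomain_quot_triple` — `A ⧸ ((t, ℓ) + (o))` a domain ⇒ `C ⧸ ((w) + (φ o) + (u'))` a domain
  (the next step's transversality hypothesis);
* `chartBase_notMem_span_pair_chartFamily` — `o ∉ (t, ℓ) ⇒ φ o ∉ (w) + (u')` (the letter `o` does not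
  vanish on the plane centre `V(w, u')`).

Arbitrary commutative rings; nothing here is a statement of the manuscript under review.

## References

* The Stacks Project, Tags 0804, 07Z3, 0BIQ. [StacksProject]
* U. Görtz, T. Wedhorn, *Algebraic Geometry I*, 2nd ed. 2020, Prop. 13.96 (2), (13.19). [GortzWedhorn2020]
-/

-- `Summit.<Summit>.<Sub>.Theorems` with `Sub = Summit` (single-conjunct summit, D-0017)
set_option linter.dupNamespace false

noncomputable section

open CategoryTheory CategoryTheory.Limits AlgebraicGeometry Literature.AlgebraicGeometry.Resolution
open IsLocalRing

namespace Summit.ResolutionOfSingularities.ResolutionOfSingularities.Theorems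

namespace ConeRung

universe u

/-- **`R[I/b] ⧸ (r̄) ≅ R ⧸ (r)` with values** (`I ⊆ (b)`, `b` a non-zero-divisor): the class of
`algebraMap x` goes to the class of `x`. [cite: GortzWedhorn2020, (13.19) p. 415] -/
theorem quot_bot_blowupAlgebra_exists_equiv {R : Type u} [CommRing R] (I : Ideal R) (b : R)
    (hb : b ∈ nonZeroDivisors R) (h : I ≤ Ideal.span {b}) (r : R) :
    ∃ e : (blowupAlgebra I b ⧸ Ideal.span {algebraMap R (blowupAlgebra I b) r}) ≃+* (R ⧸ Ideal.span {r}),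
      ∀ x : R, e (Ideal.Quotient.mk _ (algebraMap R (blowupAlgebra I b) x)) = Ideal.Quotient.mk _ x := by
  have hinj : Function.Injective (algebraMap R (Localization.Away b)) :=
    IsLocalization.injective (Localization.Away b) (Submonoid.powers_le.mpr hb)
  let e0 : blowupAlgebra I b ≃ₐ[R] (⊥ : Subalgebra R (Localization.Away b)) :=
    Subalgebra.equivOfEq _ _ (blowupAlgebra_eq_bot_of_le_span I b h)
  let e1 : (⊥ : Subalgebra R (Localization.Away b)) ≃ₐ[R] R := Algebra.botEquivOfInjective hinj
  let e : blowupAlgebra I b ≃+* R := (e0.trans e1).toRingEquiv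
  have he : ∀ x : R, e (algebraMap R (blowupAlgebra I b) x) = x := fun x => by
    change (e0.trans e1) (algebraMap R (blowupAlgebra I b) x) = x
    rw [AlgEquiv.commutes]
    rfl
  refine ⟨Ideal.quotientEquiv _ _ e (by
    rw [Ideal.map_span _ ({algebraMap R (blowupAlgebra I b) r} : Set (blowupAlgebra I b)),
      Set.image_singleton]
    change _ = Ideal.span {e (algebraMap R (blowupAlgebra I b) r)}
    rw [he]), fun x => ?_⟩
  rw [Ideal.quotientEquiv_mk]
  change Ideal.Quotient.mk _ (e (algebraMap R (blowupAlgebra I b) x)) = _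
  rw [he]

section CodimTwo

variable {A : Type u} [CommRing A] (t ℓ o : A)

local notation3 "cc" => (Fin.cons t (fun _ : Fin 1 => ℓ) : Fin 2 → A)
local notation3 "II" => Ideal.span (Set.range (Fin.cons t (fun _ : Fin 1 => ℓ) : Fin 2 → A))
local notation3 "C" => chartRing cc (Fin.succ 0)
local notation3 "ψ" => chartBase cc (Fin.succ 0)
local notation3 "w" => chartBase cc (Fin.succ 0) (cc (Fin.succ 0))
local notation3 "u'" => chartGen cc (Fin.succ 0) 0

/-- **`r ∉ (t) + (o) ⇒ φ r ∉ (u') + (φ o)`** — e.g. the letter `ℓ` does not vanish on the next centre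
`V(u', φ o)` when `ℓ ∉ (t, o)`.  Through brick 2's `C/(u') ≅ (A/(t))[(ℓ̄)/ℓ̄] = A/(t)`.
[cite: GortzWedhorn2020, Prop. 13.96 (2)] -/
theorem transv_chartBase_notMem_pair (hc : IsQuasiRegular cc) [IsDomain (A ⧸ II)]
    [IsDomain (A ⧸ Ideal.span {t})] (hℓ : ℓ ∉ Ideal.span {t}) {r : A}
    (hr : r ∉ Ideal.span {t} ⊔ Ideal.span {o}) : ψ r ∉ Ideal.span {u'} ⊔ Ideal.span {ψ o} := by
  obtain ⟨e, he⟩ := strictExc_exists_quot_equiv t (fun _ : Fin 1 => ℓ) 0 hc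
  have hne : Ideal.Quotient.mk (Ideal.span {t}) (cc (Fin.succ 0)) ≠ 0 := by
    rw [Fin.cons_succ, Ne, Ideal.Quotient.eq_zero_iff_mem]
    exact hℓ
  obtain ⟨e2, he2⟩ := quot_bot_blowupAlgebra_exists_equiv
    ((II).map (Ideal.Quotient.mk (Ideal.span {t}))) _
    (mem_nonZeroDivisors_of_ne_zero hne) (map_span_pair_le_span t ℓ)
    (Ideal.Quotient.mk (Ideal.span {t}) o)
  intro h
  -- push `φ r ∈ (u') + (φ o)` through `C → C/(u') ≅ B → B/(ō) ≅ (A/(t))/(ō)`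
  have h1 : Ideal.Quotient.mk (Ideal.span {u'}) (ψ r) ∈
      (Ideal.span {ψ o}).map (Ideal.Quotient.mk (Ideal.span {u'})) := by
    have := Ideal.mem_map_of_mem (Ideal.Quotient.mk (Ideal.span {u'})) h
    rwa [Ideal.map_sup, Ideal.map_quotient_self, bot_sup_eq] at this
  rw [Ideal.map_span _ ({ψ o} : Set C), Set.image_singleton] at h1
  have h2 : e (Ideal.Quotient.mk _ (ψ r)) ∈ Ideal.span {e (Ideal.Quotient.mk _ (ψ o))} := by
    obtain ⟨y, hy⟩ := Ideal.mem_span_singleton'.mp h1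
    exact Ideal.mem_span_singleton'.mpr ⟨e y, by rw [← map_mul, hy]⟩
  rw [he, he] at h2
  have h3 := he2 (Ideal.Quotient.mk (Ideal.span {t}) r)
  rw [Ideal.Quotient.eq_zero_iff_mem.mpr h2, map_zero] at h3
  have h4 : Ideal.Quotient.mk (Ideal.span {t}) r ∈
      Ideal.span {Ideal.Quotient.mk (Ideal.span {t}) o} := Ideal.Quotient.eq_zero_iff_mem.mp h3.symm
  rw [← Set.image_singleton, ← Ideal.map_span _ ({o} : Set A), Ideal.mem_quotient_iff_mem_sup] at h4
  exact hr (by rwa [sup_comm] at h4)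

/-- **Transversality one level up**: if `A ⧸ ((t, ℓ) + (o))` is a domain then so is
`C ⧸ ((w) + (φ o) + (u'))` — the next step's centre letters `(w = ℓ', u' = c')` together with the
transversal `φ o` (stage isomorphism with no variables left). [cite: StacksProject, Tag 0BIQ] -/
theorem transv_isDomain_quot_triple (hc : IsQuasiRegular cc) [IsDomain (A ⧸ (II ⊔ Ideal.span {o}))] :
    IsDomain (C ⧸ (Ideal.span {w} ⊔ Ideal.span {ψ o} ⊔ Ideal.span {u'})) := by
  have hstage : chartStageIdeal cc (Fin.succ 0) (Ideal.span {o}) {0} =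
      Ideal.span {w} ⊔ Ideal.span {ψ o} ⊔ Ideal.span {u'} := by
    rw [chartStageIdeal, Ideal.map_span _ ({o} : Set A), Set.image_singleton, Set.image_singleton]
  have e := chartStageEquiv cc (Fin.succ 0) (Ideal.span {o}) {0} hc (by simp)
  rw [hstage] at e
  exact MulEquiv.isDomain _ e.symm.toMulEquiv

/-- **`o ∉ (t, ℓ) ⇒ φ o ∉ (w) + (u')`**: the letter `o` does not vanish on the plane centre `V(w, u')`
(the stage quotient `C/(w, u') ≅ A/(t, ℓ)` carries `φ o` to `ō`). [cite: StacksProject, Tag 0BIQ] -/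
theorem chartBase_notMem_span_pair_chartFamily (hc : IsQuasiRegular cc) [Nontrivial (A ⧸ II)]
    (ho : o ∉ II) : ψ o ∉ Ideal.span {w} ⊔ Ideal.span {u'} := by
  intro h
  have hstage : chartStageIdeal cc (Fin.succ 0) ⊥ {0} = Ideal.span {w} ⊔ Ideal.span {u'} := by
    rw [chartStageIdeal, Ideal.map_bot, sup_bot_eq, Set.image_singleton]
  have hC : chartStageEquiv cc (Fin.succ 0) ⊥ {0} hc (by simp)
      (MvPolynomial.C (Ideal.Quotient.mk _ o)) = Ideal.Quotient.mk _ (ψ o) := chartStageEquiv_C _ _ _ _ hc _ o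
  rw [← hstage] at h
  rw [Ideal.Quotient.eq_zero_iff_mem.mpr h, map_eq_zero_iff _ (chartStageEquiv cc _ _ _ hc _).injective,
    MvPolynomial.C_eq_zero, Ideal.Quotient.eq_zero_iff_mem, sup_bot_eq] at hC
  exact ho hC

end CodimTwo

end ConeRung

end Summit.ResolutionOfSingularities.ResolutionOfSingularities.Theorems

end
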